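import Literature.Geometry.Symplectic.SteinOneHandlebodies
import HarnessLib

/-!
# Pseudoconvexity of spherical shapes `{|y|² = θ(|x|²)}` in `ℂ²` (Forstnerič–Kozak, Prop. 2.1)

Topic `Literature/Geometry/Symplectic`; proofs file of the fact seat of
`Literature.Geometry.Symplectic.Gompf1998_thm13_twoHandles` (**E2**, `SteinTwoHandles.lean`).
Eliashberg's holomorphic gluing (Gompf 1998, Thm. 1.3 and p. 622) attaches the standard handle,
a neighbourhood of the Lagrangian disc `M = {iy : |y| ≤ 1} ⊂ iℝ² ⊂ ℂ²`, to the quadric domain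
`D_λ = {x + iy : |y|² ≥ 1 + λ|x|²}` (`λ > 1`) along the Legendrian circle `{iy : |y| = 1}`;
the strongly pseudoconvex handlebodies doing this are the "spherical" domains
`{|x| ≤ f⁻¹(|y|)}` of Eliashberg (1990), Lemma 3.4.3 = Forstnerič–Kozak (2003), Prop. 3.1,
whose strong pseudoconvexity is read off from the following criterion (Forstnerič–Kozak,
Prop. 2.1, quoting the case needed here, `n = 2`): *"The domain
`D₋ = {x + iy ∈ ℂⁿ : |y|² < θ(|x|²)}` is strongly pseudoconvex along the hypersurface
`Σ = {|y|² = θ(|x|²)}` if and only if `θ` satisfies `θ' < 1`,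
`2|x|² θ θ'' < (1 - θ')(|x|² θ'² + θ)` … The domain `D₊ = {|y|² > θ(|x|²)}` is strongly
pseudoconvex along `Σ` if and only if the reverse inequalities hold"* (a sufficient condition
is (∗), (∗∗) on p. 39 of Eliashberg 1990).  This file proves the "if" directions for `n = 2`
in the flat formalism of `SteinOneHandlebodies.lean` (constant complex structure
`J₁ = scaledComplexStructure 1` of `ℝ⁴ = ℝ²_{y} ⊕ ℝ²_{x}`, `J₁ ∂_{u₀} = ∂_{u₂}`, flat Levi form
`D²ρ(v, v) + D²ρ(J₁v, J₁v) = -dd^ℂρ(v, J₁v)`, `neg_extDeriv_dComplexFlat_self`), for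
`ρ(u) = (u₀² + u₁²) - θ(u₂² + u₃²)` (so `y = (u₀, u₁)` spans the plane of the core disc and
`x = (u₂, u₃)`):

* `spherical θ` — the defining function `ρ = |y|² - θ(|x|²)`; `fderiv_spherical_apply`,
  `fderiv_fderiv_spherical_apply` — its first and second derivatives;
* `shape_alg_neg`, `shape_alg_pos` — the algebra of Forstnerič–Kozak's proof for `n = 2`
  without their `O(n)`-reduction: on the complex tangency (`dρ(v) = dρ(J₁v) = 0`) one has the
  identity `(x^⊥·y)² |v|² = ((x·v_x)² + (x·v_y)²)(|y|² + |x|² θ'²)`, whence the sign of the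
  Levi form `2(1 - θ')|v|² - 4θ''((x·v_x)² + (x·v_y)²)`;
* `levi_spherical_neg` — **`D₊ = {ρ > 0}` is strongly pseudoconvex** at a point of `Σ` where
  `θ > 0`, `θ' > 1` and `2|x|²θθ'' > (1 - θ')(|x|²θ'² + θ)`: the flat Levi form of `ρ` is
  negative on the complex tangency; `levi_spherical_pos` — the `D₋` version;
* `neg_extDeriv_dComplexFlat_spherical_neg/pos` — the same in the tree's `-dd^ℂ` language;
* `levi_quadricDomain_neg` — Example 2.4 of Forstnerič–Kozak: the quadric domain
  `D_λ = {|y|² ≥ λ|x|² + a}`, `λ > 1`, satisfies the hypotheses at every boundary point.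

Everything is **proved**; one definition (`spherical`), no named fact.

## References

* F. Forstnerič, J. Kozak, *Strongly pseudoconvex handlebodies*, J. Korean Math. Soc. 40
  (2003), 727–745 (arXiv:math/0305237), Prop. 2.1, Cor. 2.2, Example 2.4, Prop. 3.1.
  [ForstnericKozak2003]
* Ya. Eliashberg, *Topological characterization of Stein manifolds of dimension > 2*,
  Internat. J. Math. 1 (1990), 29–46, Lemma 3.4.3 and p. 39, (∗), (∗∗). [Eliashberg1990Stein]
* R. E. Gompf, *Handlebody construction of Stein surfaces*, Ann. of Math. 148 (1998),
  Thm. 1.3 and p. 622. [Gompf1998]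
-/

noncomputable section

open scoped Manifold ContDiff Topology
open Set Function

namespace Literature.Geometry.Symplectic

/-- The model vector space `ℝ⁴` of the tangent spaces. [folklore] -/
local notation "E4" => EuclideanSpace ℝ (Fin 4)

/-! ### §1 The algebra of the complex tangency -/

/-- **Forstnerič–Kozak's computation, `n = 2`, `D₊` side.**  Write `y = (u₀, u₁)`,
`x = (u₂, u₃)`, `v_y = (v₀, v₁)`, `v_x = (v₂, v₃)`, `b = θ'`, `c = θ''`.  On the complex
tangency `y·v_y = b (x·v_x)`, `y·v_x = -b (x·v_y)` of `Σ = {|y|² = θ(|x|²)}`, if `b > 1`,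
`|y|² > 0` and `(1 - b)(|x|² b² + |y|²) < 2|x|²|y|² c`, then
`2(1 - b)|v|² - 4c((x·v_x)² + (x·v_y)²) < 0` for `v ≠ 0`.
[cite: ForstnericKozak2003, Prop. 2.1] -/
theorem shape_alg_neg {u0 u1 u2 u3 v0 v1 v2 v3 b c : ℝ} (hb : 1 < b)
    (ha : 0 < u0 ^ 2 + u1 ^ 2)
    (hc : (1 - b) * ((u2 ^ 2 + u3 ^ 2) * b ^ 2 + (u0 ^ 2 + u1 ^ 2)) <
      2 * (u2 ^ 2 + u3 ^ 2) * (u0 ^ 2 + u1 ^ 2) * c)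
    (h1 : u0 * v0 + u1 * v1 = b * (u2 * v2 + u3 * v3))
    (h2 : u0 * v2 + u1 * v3 = -(b * (u2 * v0 + u3 * v1)))
    (hv : 0 < v0 ^ 2 + v1 ^ 2 + v2 ^ 2 + v3 ^ 2) :
    2 * (1 - b) * (v0 ^ 2 + v1 ^ 2 + v2 ^ 2 + v3 ^ 2) -
      4 * c * ((u2 * v2 + u3 * v3) ^ 2 + (u2 * v0 + u3 * v1) ^ 2) < 0 := by
  set S := u2 ^ 2 + u3 ^ 2 with hS
  set a := u0 ^ 2 + u1 ^ 2 with haa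
  set V := v0 ^ 2 + v1 ^ 2 + v2 ^ 2 + v3 ^ 2 with hV
  set A := u2 * v2 + u3 * v3 with hA
  set B := u2 * v0 + u3 * v1 with hB
  set N := A ^ 2 + B ^ 2 with hN
  set m' := u2 * u1 - u3 * u0 with hm'
  have hS0 : 0 ≤ S := by positivity
  have hN0 : 0 ≤ N := by positivity
  -- the key identity, multiplied by `S`
  have key : S * (m' ^ 2 * V) = S * (N * (a + S * b ^ 2)) := by
    simp only [hS, haa, hV, hA, hB, hN, hm']
    linear_combination
      ((u2 ^ 2 + u3 ^ 2) ^ 2 * ((u0 * v2 + u1 * v3) - b * (u2 * v0 + u3 * v1)) -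
          2 * (u2 ^ 2 + u3 ^ 2) * (u2 * u0 + u3 * u1) * (u2 * v2 + u3 * v3)) * h2 +
        ((u2 ^ 2 + u3 ^ 2) ^ 2 * ((u0 * v0 + u1 * v1) + b * (u2 * v2 + u3 * v3)) -
          2 * (u2 ^ 2 + u3 ^ 2) * (u2 * u0 + u3 * u1) * (u2 * v0 + u3 * v1)) * h1
  -- Lagrange: `(x·y)² + (x^⊥·y)² = |x|²|y|²`, so `m'² ≤ S a`
  have hm'le : m' ^ 2 ≤ S * a := by
    have hlag : (u2 * u0 + u3 * u1) ^ 2 + m' ^ 2 = S * a := by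
      simp only [hS, haa, hm']; ring
    have hsq : 0 ≤ (u2 * u0 + u3 * u1) ^ 2 := sq_nonneg _
    linarith
  -- `N (a + S b²) ≤ S a V`
  have hNle : N * (a + S * b ^ 2) ≤ S * a * V := by
    rcases hS0.lt_or_eq with hSpos | hS0'
    · have h3 : m' ^ 2 * V = N * (a + S * b ^ 2) := mul_left_cancel₀ hSpos.ne' key
      rw [← h3]
      exact mul_le_mul_of_nonneg_right hm'le hv.le
    · -- `x = 0`: then `A = B = 0`
      have hu2 : u2 = 0 := by
        have h : u2 ^ 2 = 0 := by linarith [sq_nonneg u2, sq_nonneg u3]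
        exact pow_eq_zero_iff two_ne_zero |>.1 h
      have hu3 : u3 = 0 := by
        have h : u3 ^ 2 = 0 := by linarith [sq_nonneg u2, sq_nonneg u3]
        exact pow_eq_zero_iff two_ne_zero |>.1 h
      have hN' : N = 0 := by simp only [hN, hA, hB, hu2, hu3]; ring
      rw [hN', ← hS0']
      simp
  have hpos : 0 < a + S * b ^ 2 := by positivity
  rcases le_or_gt 0 c with hc0 | hc0
  · -- `c ≥ 0`: both terms have the right sign
    have h4 : (1 - b) * V < 0 := mul_neg_of_neg_of_pos (by linarith) hv
    have h4' : 0 ≤ c * N := mul_nonneg hc0 hN0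
    linarith
  · -- `c < 0`: use `2|c| N (a + S b²) ≤ 2|c| S a V < (b - 1)(S b² + a) V`
    have h5 : -(2 * c) * (N * (a + S * b ^ 2)) ≤ -(2 * c) * (S * a * V) :=
      mul_le_mul_of_nonneg_left hNle (by linarith)
    have h6a : -(2 * c) * (S * a) < (b - 1) * (S * b ^ 2 + a) := by linarith
    have h6 : -(2 * c) * (S * a) * V < (b - 1) * (S * b ^ 2 + a) * V :=
      mul_lt_mul_of_pos_right h6a hv
    have h8 : (-(2 * c) * N) * (a + S * b ^ 2) < ((b - 1) * V) * (a + S * b ^ 2) :=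
      calc (-(2 * c) * N) * (a + S * b ^ 2) = -(2 * c) * (N * (a + S * b ^ 2)) := by ring
        _ ≤ -(2 * c) * (S * a * V) := h5
        _ = -(2 * c) * (S * a) * V := by ring
        _ < (b - 1) * (S * b ^ 2 + a) * V := h6
        _ = ((b - 1) * V) * (a + S * b ^ 2) := by ring
    have h7 : -(2 * c) * N < (b - 1) * V := lt_of_mul_lt_mul_right h8 hpos.le
    linarith

/-- **Forstnerič–Kozak's computation, `n = 2`, `D₋` side**: with `b = θ' < 1`, `|y|² > 0` and
`2|x|²|y|² c < (1 - b)(|x|² b² + |y|²)`, on the complex tangency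
`2(1 - b)|v|² - 4c((x·v_x)² + (x·v_y)²) > 0` for `v ≠ 0`. [cite: ForstnericKozak2003, Prop. 2.1] -/
theorem shape_alg_pos {u0 u1 u2 u3 v0 v1 v2 v3 b c : ℝ} (hb : b < 1)
    (ha : 0 < u0 ^ 2 + u1 ^ 2)
    (hc : 2 * (u2 ^ 2 + u3 ^ 2) * (u0 ^ 2 + u1 ^ 2) * c <
      (1 - b) * ((u2 ^ 2 + u3 ^ 2) * b ^ 2 + (u0 ^ 2 + u1 ^ 2)))
    (h1 : u0 * v0 + u1 * v1 = b * (u2 * v2 + u3 * v3))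
    (h2 : u0 * v2 + u1 * v3 = -(b * (u2 * v0 + u3 * v1)))
    (hv : 0 < v0 ^ 2 + v1 ^ 2 + v2 ^ 2 + v3 ^ 2) :
    0 < 2 * (1 - b) * (v0 ^ 2 + v1 ^ 2 + v2 ^ 2 + v3 ^ 2) -
      4 * c * ((u2 * v2 + u3 * v3) ^ 2 + (u2 * v0 + u3 * v1) ^ 2) := by
  set S := u2 ^ 2 + u3 ^ 2 with hS
  set a := u0 ^ 2 + u1 ^ 2 with haa
  set V := v0 ^ 2 + v1 ^ 2 + v2 ^ 2 + v3 ^ 2 with hV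
  set A := u2 * v2 + u3 * v3 with hA
  set B := u2 * v0 + u3 * v1 with hB
  set N := A ^ 2 + B ^ 2 with hN
  set m' := u2 * u1 - u3 * u0 with hm'
  have hS0 : 0 ≤ S := by positivity
  have hN0 : 0 ≤ N := by positivity
  have key : S * (m' ^ 2 * V) = S * (N * (a + S * b ^ 2)) := by
    simp only [hS, haa, hV, hA, hB, hN, hm']
    linear_combination
      ((u2 ^ 2 + u3 ^ 2) ^ 2 * ((u0 * v2 + u1 * v3) - b * (u2 * v0 + u3 * v1)) -
          2 * (u2 ^ 2 + u3 ^ 2) * (u2 * u0 + u3 * u1) * (u2 * v2 + u3 * v3)) * h2 +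
        ((u2 ^ 2 + u3 ^ 2) ^ 2 * ((u0 * v0 + u1 * v1) + b * (u2 * v2 + u3 * v3)) -
          2 * (u2 ^ 2 + u3 ^ 2) * (u2 * u0 + u3 * u1) * (u2 * v0 + u3 * v1)) * h1
  have hm'le : m' ^ 2 ≤ S * a := by
    have hlag : (u2 * u0 + u3 * u1) ^ 2 + m' ^ 2 = S * a := by
      simp only [hS, haa, hm']; ring
    have hsq : 0 ≤ (u2 * u0 + u3 * u1) ^ 2 := sq_nonneg _
    linarith
  have hNle : N * (a + S * b ^ 2) ≤ S * a * V := by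
    rcases hS0.lt_or_eq with hSpos | hS0'
    · have h3 : m' ^ 2 * V = N * (a + S * b ^ 2) := mul_left_cancel₀ hSpos.ne' key
      rw [← h3]
      exact mul_le_mul_of_nonneg_right hm'le hv.le
    · have hu2 : u2 = 0 := by
        have h : u2 ^ 2 = 0 := by linarith [sq_nonneg u2, sq_nonneg u3]
        exact pow_eq_zero_iff two_ne_zero |>.1 h
      have hu3 : u3 = 0 := by
        have h : u3 ^ 2 = 0 := by linarith [sq_nonneg u2, sq_nonneg u3]
        exact pow_eq_zero_iff two_ne_zero |>.1 h
      have hN' : N = 0 := by simp only [hN, hA, hB, hu2, hu3]; ring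
      rw [hN', ← hS0']
      simp
  have hpos : 0 < a + S * b ^ 2 := by positivity
  rcases le_or_gt c 0 with hc0 | hc0
  · have h4 : 0 < (1 - b) * V := mul_pos (by linarith) hv
    have h4' : 0 ≤ -c * N := mul_nonneg (by linarith) hN0
    linarith
  · have h5 : (2 * c) * (N * (a + S * b ^ 2)) ≤ (2 * c) * (S * a * V) :=
      mul_le_mul_of_nonneg_left hNle (by linarith)
    have h6a : (2 * c) * (S * a) < (1 - b) * (S * b ^ 2 + a) := by linarith
    have h6 : (2 * c) * (S * a) * V < (1 - b) * (S * b ^ 2 + a) * V :=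
      mul_lt_mul_of_pos_right h6a hv
    have h8 : ((2 * c) * N) * (a + S * b ^ 2) < ((1 - b) * V) * (a + S * b ^ 2) :=
      calc ((2 * c) * N) * (a + S * b ^ 2) = (2 * c) * (N * (a + S * b ^ 2)) := by ring
        _ ≤ (2 * c) * (S * a * V) := h5
        _ = (2 * c) * (S * a) * V := by ring
        _ < (1 - b) * (S * b ^ 2 + a) * V := h6
        _ = ((1 - b) * V) * (a + S * b ^ 2) := by ring
    have h7 : (2 * c) * N < (1 - b) * V := lt_of_mul_lt_mul_right h8 hpos.le
    linarith

/-! ### §2 The defining function `ρ = |y|² - θ(|x|²)` and its derivatives -/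

/-- **The spherical defining function** `ρ(u) = (u₀² + u₁²) - θ(u₂² + u₃²) = |y|² - θ(|x|²)`
of the hypersurface `Σ = {|y|² = θ(|x|²)} ⊂ ℂ²`, `y = (u₀, u₁)`, `x = (u₂, u₃)`, with
`J₁ ∂_{u₀} = ∂_{u₂}` (so `y + J₁x`-coordinates: the plane `{x = 0}` of the core disc is
totally real). [cite: ForstnericKozak2003, Prop. 2.1] -/
def spherical (θ : ℝ → ℝ) (u : E4) : ℝ :=
  (u 0 ^ 2 + u 1 ^ 2) - θ (u 2 ^ 2 + u 3 ^ 2)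

/-- Unfolding. [folklore] -/
theorem spherical_apply (θ : ℝ → ℝ) (u : E4) :
    spherical θ u = (u 0 ^ 2 + u 1 ^ 2) - θ (u 2 ^ 2 + u 3 ^ 2) := rfl

/-- The coordinate functionals `du_i`. [folklore] -/
abbrev crd (i : Fin 4) : E4 →L[ℝ] ℝ := EuclideanSpace.proj i

/-- `du_i (u) = u_i`. [folklore] -/
@[simp] theorem crd_apply (i : Fin 4) (u : E4) : crd i u = u i := rfl

/-- `|x|² = u₂² + u₃²` has derivative `2u₂ du₂ + 2u₃ du₃`. [folklore] -/
theorem hasFDerivAt_xsq (u : E4) :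
    HasFDerivAt (fun u : E4 => u 2 ^ 2 + u 3 ^ 2)
      ((2 * u 2) • (crd 2 : E4 →L[ℝ] ℝ) + (2 * u 3) • (crd 3 : E4 →L[ℝ] ℝ)) u := by
  have h2 : HasFDerivAt (fun u : E4 => (crd 2 : E4 →L[ℝ] ℝ) u ^ 2) _ u :=
    ((crd 2).hasFDerivAt (x := u)).pow 2
  have h3 : HasFDerivAt (fun u : E4 => (crd 3 : E4 →L[ℝ] ℝ) u ^ 2) _ u :=
    ((crd 3).hasFDerivAt (x := u)).pow 2
  refine (h2.add h3).congr_fderiv ?_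
  ext v
  simp

/-- `|y|² = u₀² + u₁²` has derivative `2u₀ du₀ + 2u₁ du₁`. [folklore] -/
theorem hasFDerivAt_ysq (u : E4) :
    HasFDerivAt (fun u : E4 => u 0 ^ 2 + u 1 ^ 2)
      ((2 * u 0) • (crd 0 : E4 →L[ℝ] ℝ) + (2 * u 1) • (crd 1 : E4 →L[ℝ] ℝ)) u := by
  have h0 : HasFDerivAt (fun u : E4 => (crd 0 : E4 →L[ℝ] ℝ) u ^ 2) _ u :=
    ((crd 0).hasFDerivAt (x := u)).pow 2
  have h1 : HasFDerivAt (fun u : E4 => (crd 1 : E4 →L[ℝ] ℝ) u ^ 2) _ u :=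
    ((crd 1).hasFDerivAt (x := u)).pow 2
  refine (h0.add h1).congr_fderiv ?_
  ext v
  simp

/-- The `x`-gradient functional `L(u) = 2u₂ du₂ + 2u₃ du₃` as a function of `u`, and its
derivative `v ↦ 2v₂ du₂ + 2v₃ du₃`. [folklore] -/
theorem hasFDerivAt_xgrad (u : E4) :
    HasFDerivAt (fun u : E4 => (2 * u 2) • (crd 2 : E4 →L[ℝ] ℝ) + (2 * u 3) • (crd 3 : E4 →L[ℝ] ℝ))
      ((2 : ℝ) • (ContinuousLinearMap.smulRightL ℝ E4 ℝ (crd 2)).comp (crd 2) +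
        (2 : ℝ) • (ContinuousLinearMap.smulRightL ℝ E4 ℝ (crd 3)).comp (crd 3)) u := by
  have hs2 : HasFDerivAt (fun u : E4 => 2 * u 2) ((2 : ℝ) • (crd 2 : E4 →L[ℝ] ℝ)) u := by
    simpa using ((crd 2).hasFDerivAt (x := u)).const_mul (2 : ℝ)
  have hs3 : HasFDerivAt (fun u : E4 => 2 * u 3) ((2 : ℝ) • (crd 3 : E4 →L[ℝ] ℝ)) u := by
    simpa using ((crd 3).hasFDerivAt (x := u)).const_mul (2 : ℝ)
  have h2 := hs2.smul_const (crd 2 : E4 →L[ℝ] ℝ)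
  have h3 := hs3.smul_const (crd 3 : E4 →L[ℝ] ℝ)
  refine (h2.add h3).congr_fderiv ?_
  ext v w
  simp [ContinuousLinearMap.smulRightL, ContinuousLinearMap.smulRight_apply]
  ring

/-- Same for the `y`-gradient `2u₀ du₀ + 2u₁ du₁`. [folklore] -/
theorem hasFDerivAt_ygrad (u : E4) :
    HasFDerivAt (fun u : E4 => (2 * u 0) • (crd 0 : E4 →L[ℝ] ℝ) + (2 * u 1) • (crd 1 : E4 →L[ℝ] ℝ))
      ((2 : ℝ) • (ContinuousLinearMap.smulRightL ℝ E4 ℝ (crd 0)).comp (crd 0) +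
        (2 : ℝ) • (ContinuousLinearMap.smulRightL ℝ E4 ℝ (crd 1)).comp (crd 1)) u := by
  have hs0 : HasFDerivAt (fun u : E4 => 2 * u 0) ((2 : ℝ) • (crd 0 : E4 →L[ℝ] ℝ)) u := by
    simpa using ((crd 0).hasFDerivAt (x := u)).const_mul (2 : ℝ)
  have hs1 : HasFDerivAt (fun u : E4 => 2 * u 1) ((2 : ℝ) • (crd 1 : E4 →L[ℝ] ℝ)) u := by
    simpa using ((crd 1).hasFDerivAt (x := u)).const_mul (2 : ℝ)
  have h0 := hs0.smul_const (crd 0 : E4 →L[ℝ] ℝ)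
  have h1 := hs1.smul_const (crd 1 : E4 →L[ℝ] ℝ)
  refine (h0.add h1).congr_fderiv ?_
  ext v w
  simp [ContinuousLinearMap.smulRightL, ContinuousLinearMap.smulRight_apply]
  ring

variable {θ : ℝ → ℝ}

/-- **First derivative of `ρ`**: `dρ_u = 2u₀ du₀ + 2u₁ du₁ - θ'(|x|²)(2u₂ du₂ + 2u₃ du₃)`.
[folklore] -/
theorem hasFDerivAt_spherical (hθ : Differentiable ℝ θ) (u : E4) :
    HasFDerivAt (spherical θ)
      (((2 * u 0) • (crd 0 : E4 →L[ℝ] ℝ) + (2 * u 1) • (crd 1 : E4 →L[ℝ] ℝ)) -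
        deriv θ (u 2 ^ 2 + u 3 ^ 2) •
          ((2 * u 2) • (crd 2 : E4 →L[ℝ] ℝ) + (2 * u 3) • (crd 3 : E4 →L[ℝ] ℝ))) u := by
  have hθ' : HasDerivAt θ (deriv θ (u 2 ^ 2 + u 3 ^ 2)) (u 2 ^ 2 + u 3 ^ 2) :=
    (hθ _).hasDerivAt
  have hcomp := hθ'.comp_hasFDerivAt u (hasFDerivAt_xsq u)
  exact (hasFDerivAt_ysq u).sub hcomp

/-- `fderiv` of `ρ`. [folklore] -/
theorem fderiv_spherical (hθ : Differentiable ℝ θ) (u : E4) :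
    fderiv ℝ (spherical θ) u =
      ((2 * u 0) • (crd 0 : E4 →L[ℝ] ℝ) + (2 * u 1) • (crd 1 : E4 →L[ℝ] ℝ)) -
        deriv θ (u 2 ^ 2 + u 3 ^ 2) •
          ((2 * u 2) • (crd 2 : E4 →L[ℝ] ℝ) + (2 * u 3) • (crd 3 : E4 →L[ℝ] ℝ)) :=
  (hasFDerivAt_spherical hθ u).fderiv

/-- **`dρ_u(v) = 2(u₀v₀ + u₁v₁) - 2θ'(|x|²)(u₂v₂ + u₃v₃)`.** [cite: ForstnericKozak2003, Prop. 2.1] -/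
theorem fderiv_spherical_apply (hθ : Differentiable ℝ θ) (u v : E4) :
    fderiv ℝ (spherical θ) u v =
      2 * (u 0 * v 0 + u 1 * v 1) - deriv θ (u 2 ^ 2 + u 3 ^ 2) * (2 * (u 2 * v 2 + u 3 * v 3)) := by
  rw [fderiv_spherical hθ]
  simp
  ring

/-- **Second derivative of `ρ`**: for `θ` of class `C²`,
`D²ρ_u(v, w) = 2(v₀w₀ + v₁w₁) - θ'(|x|²) 2(v₂w₂ + v₃w₃) - θ''(|x|²) 2(u₂v₂ + u₃v₃) 2(u₂w₂ + u₃w₃)`.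
[cite: ForstnericKozak2003, Prop. 2.1] -/
theorem fderiv_fderiv_spherical_apply (hθ : ContDiff ℝ 2 θ) (u v w : E4) :
    fderiv ℝ (fderiv ℝ (spherical θ)) u v w =
      2 * (v 0 * w 0 + v 1 * w 1) -
        deriv θ (u 2 ^ 2 + u 3 ^ 2) * (2 * (v 2 * w 2 + v 3 * w 3)) -
        deriv (deriv θ) (u 2 ^ 2 + u 3 ^ 2) *
          (2 * (u 2 * v 2 + u 3 * v 3)) * (2 * (u 2 * w 2 + u 3 * w 3)) := by
  have hθd : Differentiable ℝ θ := hθ.differentiable (by norm_num)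
  have hθ1 : ContDiff ℝ 1 (deriv θ) := (contDiff_succ_iff_deriv.1 hθ).2.2
  have hθ'd : Differentiable ℝ (deriv θ) := hθ1.differentiable (by norm_num)
  -- the derivative of `u ↦ fderiv ρ u`
  set S : E4 → ℝ := fun u => u 2 ^ 2 + u 3 ^ 2 with hS
  set Lx : E4 → (E4 →L[ℝ] ℝ) :=
    fun u => (2 * u 2) • (crd 2 : E4 →L[ℝ] ℝ) + (2 * u 3) • (crd 3 : E4 →L[ℝ] ℝ) with hLx
  set Ly : E4 → (E4 →L[ℝ] ℝ) :=
    fun u => (2 * u 0) • (crd 0 : E4 →L[ℝ] ℝ) + (2 * u 1) • (crd 1 : E4 →L[ℝ] ℝ) with hLy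
  set g : E4 → ℝ := fun u => deriv θ (S u) with hg
  have hgd : HasFDerivAt g (deriv (deriv θ) (S u) • Lx u) u := by
    have h1 : HasDerivAt (deriv θ) (deriv (deriv θ) (S u)) (S u) := (hθ'd _).hasDerivAt
    exact h1.comp_hasFDerivAt u (hasFDerivAt_xsq u)
  have hprod : HasFDerivAt (fun u => g u • Lx u)
      (g u • ((2 : ℝ) • (ContinuousLinearMap.smulRightL ℝ E4 ℝ (crd 2)).comp (crd 2) +
        (2 : ℝ) • (ContinuousLinearMap.smulRightL ℝ E4 ℝ (crd 3)).comp (crd 3)) +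
        (deriv (deriv θ) (S u) • Lx u).smulRight (Lx u)) u :=
    hgd.smul (hasFDerivAt_xgrad u)
  have hall : HasFDerivAt (fun u => Ly u - g u • Lx u)
      (((2 : ℝ) • (ContinuousLinearMap.smulRightL ℝ E4 ℝ (crd 0)).comp (crd 0) +
        (2 : ℝ) • (ContinuousLinearMap.smulRightL ℝ E4 ℝ (crd 1)).comp (crd 1)) -
        (g u • ((2 : ℝ) • (ContinuousLinearMap.smulRightL ℝ E4 ℝ (crd 2)).comp (crd 2) +
          (2 : ℝ) • (ContinuousLinearMap.smulRightL ℝ E4 ℝ (crd 3)).comp (crd 3)) +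
          (deriv (deriv θ) (S u) • Lx u).smulRight (Lx u))) u :=
    (hasFDerivAt_ygrad u).sub hprod
  have heq : (fun u => Ly u - g u • Lx u) = fderiv ℝ (spherical θ) := by
    funext u'
    rw [fderiv_spherical hθd u']
  rw [heq] at hall
  rw [hall.fderiv]
  simp [ContinuousLinearMap.smulRightL, ContinuousLinearMap.smulRight_apply, hg, hLx, hS]
  ring

/-- `ρ` is `C^n` when `θ` is. [folklore] -/
theorem contDiff_spherical {n : WithTop ℕ∞} (hθ : ContDiff ℝ n θ) : ContDiff ℝ n (spherical θ) := by
  have h0 : ContDiff ℝ n fun u : E4 => u 0 ^ 2 + u 1 ^ 2 :=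
    ((crd 0).contDiff.pow 2).add ((crd 1).contDiff.pow 2)
  have h2 : ContDiff ℝ n fun u : E4 => u 2 ^ 2 + u 3 ^ 2 :=
    ((crd 2).contDiff.pow 2).add ((crd 3).contDiff.pow 2)
  exact h0.sub (hθ.comp h2)

/-! ### §3 The criterion -/

/-- **Forstnerič–Kozak, Prop. 2.1 (`n = 2`, the domain `D₊`).**  Let `θ` be of class `C²`,
`u ∈ Σ = {ρ = 0}` (`ρ = |y|² - θ(|x|²)`) with `θ(|x|²) > 0`, and suppose the reverse
inequalities `θ' > 1`, `2|x|²θθ'' > (1 - θ')(|x|²θ'² + θ)` hold at `|x|² = u₂² + u₃²`.  Then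
the flat Levi form of `ρ` is **negative** on the complex tangency of `Σ` at `u`:
`D²ρ_u(v, v) + D²ρ_u(J₁v, J₁v) < 0` for every `v ≠ 0` with `dρ_u(v) = dρ_u(J₁v) = 0`; that is,
`D₊ = {ρ > 0} = {|y|² > θ(|x|²)}` is strongly pseudoconvex at `u`.
[cite: ForstnericKozak2003, Prop. 2.1] -/
theorem levi_spherical_neg (hθ : ContDiff ℝ 2 θ) {u : E4} (hρ : spherical θ u = 0)
    (hpos : 0 < θ (u 2 ^ 2 + u 3 ^ 2)) (hb : 1 < deriv θ (u 2 ^ 2 + u 3 ^ 2))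
    (hc : (1 - deriv θ (u 2 ^ 2 + u 3 ^ 2)) *
        ((u 2 ^ 2 + u 3 ^ 2) * deriv θ (u 2 ^ 2 + u 3 ^ 2) ^ 2 + θ (u 2 ^ 2 + u 3 ^ 2)) <
      2 * (u 2 ^ 2 + u 3 ^ 2) * θ (u 2 ^ 2 + u 3 ^ 2) * deriv (deriv θ) (u 2 ^ 2 + u 3 ^ 2))
    {v : E4} (hv : v ≠ 0) (h1 : fderiv ℝ (spherical θ) u v = 0)
    (h2 : fderiv ℝ (spherical θ) u (scaledComplexStructure 1 v) = 0) :
    fderiv ℝ (fderiv ℝ (spherical θ)) u v v +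
      fderiv ℝ (fderiv ℝ (spherical θ)) u (scaledComplexStructure 1 v)
        (scaledComplexStructure 1 v) < 0 := by
  have hθd : Differentiable ℝ θ := hθ.differentiable (by norm_num)
  have hy : u 0 ^ 2 + u 1 ^ 2 = θ (u 2 ^ 2 + u 3 ^ 2) := by
    have := hρ; rw [spherical_apply] at this; linarith
  rw [fderiv_spherical_apply hθd] at h1 h2
  rw [fderiv_fderiv_spherical_apply hθ, fderiv_fderiv_spherical_apply hθ]
  simp only [scaledComplexStructure_apply_zero, scaledComplexStructure_apply_one,
    scaledComplexStructure_apply_two, scaledComplexStructure_apply_three, inv_one, one_mul] at h1 h2 ⊢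
  set b := deriv θ (u 2 ^ 2 + u 3 ^ 2) with hbdef
  set c := deriv (deriv θ) (u 2 ^ 2 + u 3 ^ 2) with hcdef
  have h1' : u 0 * v 0 + u 1 * v 1 = b * (u 2 * v 2 + u 3 * v 3) := by
    linear_combination h1 / 2
  have h2' : u 0 * v 2 + u 1 * v 3 = -(b * (u 2 * v 0 + u 3 * v 1)) := by
    linear_combination (-1 / 2 : ℝ) * h2
  have ha : 0 < u 0 ^ 2 + u 1 ^ 2 := by rw [hy]; exact hpos
  have hc' : (1 - b) * ((u 2 ^ 2 + u 3 ^ 2) * b ^ 2 + (u 0 ^ 2 + u 1 ^ 2)) <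
      2 * (u 2 ^ 2 + u 3 ^ 2) * (u 0 ^ 2 + u 1 ^ 2) * c := by rw [hy]; exact hc
  have hvn : 0 < v 0 ^ 2 + v 1 ^ 2 + v 2 ^ 2 + v 3 ^ 2 := by
    have : ‖v‖ ^ 2 = v 0 ^ 2 + v 1 ^ 2 + v 2 ^ 2 + v 3 ^ 2 := norm_sq_four v
    rw [← this]
    exact pow_pos (norm_pos_iff.2 hv) 2
  have key := shape_alg_neg hb ha hc' h1' h2' hvn
  linear_combination key

/-- **Forstnerič–Kozak, Prop. 2.1 (`n = 2`, the domain `D₋`).**  With `θ' < 1` and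
`2|x|²θθ'' < (1 - θ')(|x|²θ'² + θ)` at `u ∈ Σ` (`θ > 0` there), the flat Levi form of `ρ` is
**positive** on the complex tangency: `D₋ = {ρ < 0} = {|y|² < θ(|x|²)}` is strongly
pseudoconvex at `u`. [cite: ForstnericKozak2003, Prop. 2.1] -/
theorem levi_spherical_pos (hθ : ContDiff ℝ 2 θ) {u : E4} (hρ : spherical θ u = 0)
    (hpos : 0 < θ (u 2 ^ 2 + u 3 ^ 2)) (hb : deriv θ (u 2 ^ 2 + u 3 ^ 2) < 1)
    (hc : 2 * (u 2 ^ 2 + u 3 ^ 2) * θ (u 2 ^ 2 + u 3 ^ 2) * deriv (deriv θ) (u 2 ^ 2 + u 3 ^ 2) <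
      (1 - deriv θ (u 2 ^ 2 + u 3 ^ 2)) *
        ((u 2 ^ 2 + u 3 ^ 2) * deriv θ (u 2 ^ 2 + u 3 ^ 2) ^ 2 + θ (u 2 ^ 2 + u 3 ^ 2)))
    {v : E4} (hv : v ≠ 0) (h1 : fderiv ℝ (spherical θ) u v = 0)
    (h2 : fderiv ℝ (spherical θ) u (scaledComplexStructure 1 v) = 0) :
    0 < fderiv ℝ (fderiv ℝ (spherical θ)) u v v +
      fderiv ℝ (fderiv ℝ (spherical θ)) u (scaledComplexStructure 1 v)
        (scaledComplexStructure 1 v) := by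
  have hθd : Differentiable ℝ θ := hθ.differentiable (by norm_num)
  have hy : u 0 ^ 2 + u 1 ^ 2 = θ (u 2 ^ 2 + u 3 ^ 2) := by
    have := hρ; rw [spherical_apply] at this; linarith
  rw [fderiv_spherical_apply hθd] at h1 h2
  rw [fderiv_fderiv_spherical_apply hθ, fderiv_fderiv_spherical_apply hθ]
  simp only [scaledComplexStructure_apply_zero, scaledComplexStructure_apply_one,
    scaledComplexStructure_apply_two, scaledComplexStructure_apply_three, inv_one, one_mul] at h1 h2 ⊢
  set b := deriv θ (u 2 ^ 2 + u 3 ^ 2) with hbdef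
  set c := deriv (deriv θ) (u 2 ^ 2 + u 3 ^ 2) with hcdef
  have h1' : u 0 * v 0 + u 1 * v 1 = b * (u 2 * v 2 + u 3 * v 3) := by
    linear_combination h1 / 2
  have h2' : u 0 * v 2 + u 1 * v 3 = -(b * (u 2 * v 0 + u 3 * v 1)) := by
    linear_combination (-1 / 2 : ℝ) * h2
  have ha : 0 < u 0 ^ 2 + u 1 ^ 2 := by rw [hy]; exact hpos
  have hc' : 2 * (u 2 ^ 2 + u 3 ^ 2) * (u 0 ^ 2 + u 1 ^ 2) * c <
      (1 - b) * ((u 2 ^ 2 + u 3 ^ 2) * b ^ 2 + (u 0 ^ 2 + u 1 ^ 2)) := by rw [hy]; exact hc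
  have hvn : 0 < v 0 ^ 2 + v 1 ^ 2 + v 2 ^ 2 + v 3 ^ 2 := by
    have : ‖v‖ ^ 2 = v 0 ^ 2 + v 1 ^ 2 + v 2 ^ 2 + v 3 ^ 2 := norm_sq_four v
    rw [← this]
    exact pow_pos (norm_pos_iff.2 hv) 2
  have key := shape_alg_pos hb ha hc' h1' h2' hvn
  linear_combination key

/-! ### §4 In the tree's `-dd^ℂ` language, and the quadric model -/

/-- **`D₊` in the tree's formalism**: under the hypotheses of `levi_spherical_neg` with `θ`
smooth, `-dd^ℂρ_u(v, J₁v) < 0` on the complex tangency (`dComplexFlat`,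
`neg_extDeriv_dComplexFlat_self` of `SteinOneHandlebodies.lean`). [cite: ForstnericKozak2003, Prop. 2.1] -/
theorem neg_extDeriv_dComplexFlat_spherical_neg (hθ : ContDiff ℝ ∞ θ) {u : E4}
    (hρ : spherical θ u = 0) (hpos : 0 < θ (u 2 ^ 2 + u 3 ^ 2))
    (hb : 1 < deriv θ (u 2 ^ 2 + u 3 ^ 2))
    (hc : (1 - deriv θ (u 2 ^ 2 + u 3 ^ 2)) *
        ((u 2 ^ 2 + u 3 ^ 2) * deriv θ (u 2 ^ 2 + u 3 ^ 2) ^ 2 + θ (u 2 ^ 2 + u 3 ^ 2)) <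
      2 * (u 2 ^ 2 + u 3 ^ 2) * θ (u 2 ^ 2 + u 3 ^ 2) * deriv (deriv θ) (u 2 ^ 2 + u 3 ^ 2))
    {v : E4} (hv : v ≠ 0) (h1 : fderiv ℝ (spherical θ) u v = 0)
    (h2 : fderiv ℝ (spherical θ) u (scaledComplexStructure 1 v) = 0) :
    -(extDeriv (dComplexFlat (scaledComplexStructure 1) (spherical θ)) u
        ![v, scaledComplexStructure 1 v]) < 0 := by
  rw [neg_extDeriv_dComplexFlat_self _ (contDiff_spherical hθ)
    (scaledComplexStructure_sq one_ne_zero) u v]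
  exact levi_spherical_neg (hθ.of_le (by norm_cast)) hρ hpos hb hc hv h1 h2

/-- **`D₋` in the tree's formalism**: under the hypotheses of `levi_spherical_pos` with `θ`
smooth, `-dd^ℂρ_u(v, J₁v) > 0` on the complex tangency. [cite: ForstnericKozak2003, Prop. 2.1] -/
theorem neg_extDeriv_dComplexFlat_spherical_pos (hθ : ContDiff ℝ ∞ θ) {u : E4}
    (hρ : spherical θ u = 0) (hpos : 0 < θ (u 2 ^ 2 + u 3 ^ 2))
    (hb : deriv θ (u 2 ^ 2 + u 3 ^ 2) < 1)
    (hc : 2 * (u 2 ^ 2 + u 3 ^ 2) * θ (u 2 ^ 2 + u 3 ^ 2) * deriv (deriv θ) (u 2 ^ 2 + u 3 ^ 2) <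
      (1 - deriv θ (u 2 ^ 2 + u 3 ^ 2)) *
        ((u 2 ^ 2 + u 3 ^ 2) * deriv θ (u 2 ^ 2 + u 3 ^ 2) ^ 2 + θ (u 2 ^ 2 + u 3 ^ 2)))
    {v : E4} (hv : v ≠ 0) (h1 : fderiv ℝ (spherical θ) u v = 0)
    (h2 : fderiv ℝ (spherical θ) u (scaledComplexStructure 1 v) = 0) :
    0 < -(extDeriv (dComplexFlat (scaledComplexStructure 1) (spherical θ)) u
        ![v, scaledComplexStructure 1 v]) := by
  rw [neg_extDeriv_dComplexFlat_self _ (contDiff_spherical hθ)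
    (scaledComplexStructure_sq one_ne_zero) u v]
  exact levi_spherical_pos (hθ.of_le (by norm_cast)) hρ hpos hb hc hv h1 h2

/-- **The quadric model `D_λ = {|y|² ≥ λ|x|² + a}` (`λ > 1`, `a > 0`) is strongly pseudoconvex**
(Forstnerič–Kozak, Example 2.4: `g_{λ,a} = √(λt² + a)` satisfies the reverse inequalities):
with `θ(s) = λ s + a`, at every point `u` of `∂D_λ` the flat Levi form of `ρ` is negative on
the complex tangency. [cite: ForstnericKozak2003, Example 2.4] -/
theorem levi_quadricDomain_neg {l a : ℝ} (hl : 1 < l) (ha : 0 < a) {u : E4}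
    (hρ : spherical (fun s => l * s + a) u = 0) {v : E4} (hv : v ≠ 0)
    (h1 : fderiv ℝ (spherical fun s => l * s + a) u v = 0)
    (h2 : fderiv ℝ (spherical fun s => l * s + a) u (scaledComplexStructure 1 v) = 0) :
    fderiv ℝ (fderiv ℝ (spherical fun s => l * s + a)) u v v +
      fderiv ℝ (fderiv ℝ (spherical fun s => l * s + a)) u (scaledComplexStructure 1 v)
        (scaledComplexStructure 1 v) < 0 := by
  have hθ : ContDiff ℝ 2 fun s : ℝ => l * s + a := (contDiff_const.mul contDiff_id).add contDiff_const
  have hd : deriv (fun s : ℝ => l * s + a) = fun _ => l := by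
    funext s
    have : HasDerivAt (fun s : ℝ => l * s + a) l s := by
      simpa using ((hasDerivAt_id s).const_mul l).add_const a
    exact this.deriv
  have hd' : ∀ s, deriv (fun s : ℝ => l * s + a) s = l := fun s => by rw [hd]
  have hdd' : ∀ s, deriv (deriv fun s : ℝ => l * s + a) s = 0 := fun s => by
    rw [hd]; exact deriv_const s l
  have hS0 : 0 ≤ u 2 ^ 2 + u 3 ^ 2 := by positivity
  refine levi_spherical_neg hθ hρ ?_ ?_ ?_ hv h1 h2
  · show 0 < l * (u 2 ^ 2 + u 3 ^ 2) + a
    positivity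
  · rw [hd']; exact hl
  · rw [hd', hdd', mul_zero]
    show (1 - l) * ((u 2 ^ 2 + u 3 ^ 2) * l ^ 2 + (l * (u 2 ^ 2 + u 3 ^ 2) + a)) < 0
    have h3 : 0 < (u 2 ^ 2 + u 3 ^ 2) * l ^ 2 + (l * (u 2 ^ 2 + u 3 ^ 2) + a) := by positivity
    exact mul_neg_of_neg_of_pos (by linarith) h3

end Literature.Geometry.Symplectic

end
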